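import Literature.AnabelianGeometry.EtaleTheta.ThetaCohomology
import Literature.AnabelianGeometry.EtaleTheta.ThetaCyclotomes
import Literature.AnabelianGeometry.EtaleTheta.ContH1ConjAction
import Mathlib.Tactic.Module

/-!
# [EtTh] Prop 2.14 (ii) for the §1 model, I: the `Gal(Y/X)`-translates of the étale theta class
# (class-level consequences of Prop 1.5 (ii), (iii))

Mochizuki, *The Étale Theta Function …* [EtTh], Publ. RIMS 45 (2009), §1 Prop 1.5 (PRIMS PDF
p.23) and §2 Prop 2.14 (ii) (p.49; locators `p.N` = PDF pages; bib key `MochizukiEtTh2009`).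
PROOF-ONLY companion (no definitions) of `ThetaCohomology.lean` (seat abc-iut-L2-t1), unit
"deep EtTh:Prop2.14(ii)-model (hgal)" of seat abc-iut-L2-t10 (cell abc-iut, layer L2).

The printed proof of Prop 2.14 (ii) (p.49): "the difference cocycle `δ` determines a cohomology
class of `H¹(Π^tp_Ÿ, μ_N)` that lies in the submodule generated by the Kummer classes of `K^×` and
`Ü²` [cf. Proposition 1.5, (ii), (iii)] … the meromorphic function `Ü²` on `Ÿ` descends to `Y` … the
action by an element of `Gal(Y/X)` clearly maps `Ü²` to a `K^×`-multiple of `Ü²`". This file proves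
the CLASS-LEVEL content of these three sentences over the §1 theta setting `D : ThetaSetting p`
with étale theta data `E` (real continuous `H¹` of `ContH1.lean`), from abc-iut-L2-t1's named facts
`Prop15iii` (the `Z`-action formula on `η̈^Θ`) and `Prop15ii` (`F̈² = ` the Kummer classes of `K̈^×`)
and the `KummerData` compatibilities `res_logU` (`log(U)|_Ÿ = 2·log(Ü)`), `res_kumY`, under
`K = K̈` (`Sec2Hyps.Kdd_eq`, Def 2.5):

* `conj_etaDd_div_eq` — for `σ, x ∈ Π^tp_X`: `σ·η̈^Θ − (xσ)·η̈^Θ` is the restriction to `Π^tp_Ÿ` of the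
  inflation of a class `a_x · log(U) + log(k)`, `k ∈ (K^×)^∧`, on `(Π^tp_Y)^Θ` ("descends to `Y`");
* `res_conj_logU_div_mem_Fdd2` — for `y ∈ Π^tp_X`: `(y·log(U) − log(U))|_{(Π^tp_Ÿ)^Θ} ∈ F̈²`
  ("maps `Ü²` to a `K^×`-multiple of `Ü²`"), hence `y·(a·log(U) + log(k)) − (a·log(U) + log(k))`
  vanishes on `(Δ^tp_Ÿ)^Θ` (`res_conj_descended_div_eq_one`).

Generic naturality lemmas for `ContH1` (`res_conj`, `infl_res`, `infl_conj`) come first.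
HONEST FRAMING: [EtTh] is refereed; `Prop15ii/iii` are named (unproved) §1 facts typed by t1 — the
results here are conditional on them and assert nothing else; no side taken on [IUTchIII] Cor 3.12.
-/

noncomputable section

namespace Literature.AnabelianGeometry.EtaleTheta

open Literature.AnabelianGeometry.SemiGraphs
open scoped IsMulCommutative

/-! ## Naturality of restriction, inflation and conjugation on the concrete `H¹` -/

namespace ContH1

variable {G G' : Type*} [Group G] [TopologicalSpace G] [IsTopologicalGroup G]
  [Group G'] [TopologicalSpace G'] [IsTopologicalGroup G']
  {φ : G →* G'} {A : Subgroup G'} [A.Normal] [IsMulCommutative A]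

/-- Restriction commutes with the conjugation action (both normal subgroups).
[cite: NeukirchSchmidtWingberg2008, I §5] -/
theorem res_conj {H₁ H₂ : Subgroup G} [H₁.Normal] [H₂.Normal] (h : H₁ ≤ H₂) (σ : G)
    (x : ContH1 φ A H₂) : res φ A h (conj φ A σ x) = conj φ A σ (res φ A h x) := by
  induction x using QuotientGroup.induction_on with
  | H f => rfl

variable {G₀ : Type*} [Group G₀] [TopologicalSpace G₀] [IsTopologicalGroup G₀]
  {ψ : G₀ →* G'} {hψ : Continuous ψ}

omit [IsTopologicalGroup G₀] in
/-- Inflation commutes with restriction. [cite: NeukirchSchmidtWingberg2008, I §5] -/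
theorem infl_res {H₀ H₁ : Subgroup G₀} {H' H'' : Subgroup G'} (h₀ : H₀ ≤ H₁) (h' : H' ≤ H'')
    (h1 : H₁.map ψ ≤ H'') (h0 : H₀.map ψ ≤ H') (x : ContH1 (MonoidHom.id G') A H'') :
    res ψ A h₀ (infl A ψ hψ h1 x) = infl A ψ hψ h0 (res (MonoidHom.id G') A h' x) := by
  induction x using QuotientGroup.induction_on with
  | H f => rfl

/-- Inflation commutes with the conjugation actions: `infl (ψ(τ) · x) = τ · infl x`.
[cite: NeukirchSchmidtWingberg2008, I §5] -/
theorem infl_conj {H₀ : Subgroup G₀} {H' : Subgroup G'} [H₀.Normal] [H'.Normal] (h : H₀.map ψ ≤ H')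
    (τ : G₀) (x : ContH1 (MonoidHom.id G') A H') :
    infl A ψ hψ h (conj (MonoidHom.id G') A (ψ τ) x) = conj ψ A τ (infl A ψ hψ h x) := by
  induction x using QuotientGroup.induction_on with
  | H f =>
    change (QuotientGroup.mk (inflCocycle A ψ hψ h (conjCocycle (MonoidHom.id G') A (ψ τ) f)) :
        ContH1 ψ A H₀) = QuotientGroup.mk (conjCocycle ψ A τ (inflCocycle A ψ hψ h f))
    congr 1
    apply Subtype.ext
    funext k
    have hAB : (MulAut.conjNormal (ψ τ)⁻¹ (⟨ψ (k : G₀), h ⟨k.1, k.2, rfl⟩⟩ : H') : H') =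
        ⟨ψ ((MulAut.conjNormal τ⁻¹ k : H₀) : G₀), h ⟨_, (MulAut.conjNormal τ⁻¹ k).2, rfl⟩⟩ := by
      apply Subtype.ext
      simp only [map_mul, map_inv, MulAut.conjNormal_inv_apply]
    calc (inflCocycle A ψ hψ h (conjCocycle (MonoidHom.id G') A (ψ τ) f)).1 k
        = MulAut.conjNormal (ψ τ) (f.1 (MulAut.conjNormal (ψ τ)⁻¹ ⟨ψ (k : G₀), h ⟨k.1, k.2, rfl⟩⟩)) :=
          rfl
      _ = MulAut.conjNormal (ψ τ) (f.1 ⟨ψ ((MulAut.conjNormal τ⁻¹ k : H₀) : G₀),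
            h ⟨_, (MulAut.conjNormal τ⁻¹ k).2, rfl⟩⟩) := by rw [hAB]
      _ = (conjCocycle ψ A τ (inflCocycle A ψ hψ h f)).1 k := rfl

omit [IsTopologicalGroup G] in
/-- Two cocycles with the same class differ by a coboundary, pointwise.
[cite: NeukirchSchmidtWingberg2008, I §2] -/
theorem exists_coboundary_of_mk_eq {H : Subgroup G} (f g : contCocycles φ A H)
    (h : (QuotientGroup.mk f : ContH1 φ A H) = QuotientGroup.mk g) :
    ∃ a : A, ∀ k : H, g.1 k = f.1 k * (MulAut.conjNormal (φ (k : G)) a * a⁻¹) := by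
  rw [QuotientGroup.eq, Subgroup.mem_subgroupOf, mem_contCoboundaries_iff] at h
  obtain ⟨a, ha⟩ := h
  refine ⟨a, fun k => ?_⟩
  have hk : (f.1 k)⁻¹ * g.1 k = MulAut.conjNormal (φ (k : G)) a * a⁻¹ := congrFun ha k
  rw [← hk, mul_inv_cancel_left]

end ContH1

/-! ## The §1 classes -/

namespace ThetaSetting

variable {p : ℕ} [Fact p.Prime] {D : ThetaSetting p}

/-- `(Π^tp_Y)^Θ` is normal in `(Π^tp_X)^Θ` (`Π^tp_Y = Ker(Π^tp_X ↠ Z)` is, and `Π^tp_X ↠ (Π^tp_X)^Θ` is onto).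
(A theorem; used via `haveI`.) [cite: MochizukiEtTh2009, §1 p.12] -/
theorem GtpYTheta_normal : (D.GtpY.map D.toTheta).Normal :=
  (inferInstanceAs D.toZ.ker.Normal : D.GtpY.Normal).map D.toTheta D.toTheta_surjective

/-- `(Δ^tp_Ÿ)^Θ` is normal in `(Π^tp_X)^Θ`. [cite: MochizukiEtTh2009, Prop 1.5 (ii) p.23] -/
theorem Compat.DtpYddTheta_normal (hC : D.Compat) : ((D.DtpYddN 1).map D.toTheta).Normal := by
  haveI := hC.GtpYdd_normal
  haveI : (D.DtpYddN 1).Normal := by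
    change (D.GtpYdd ⊓ D.DeltaTemp).Normal
    haveI : D.DeltaTemp.Normal := inferInstanceAs D.aug.toMonoidHom.ker.Normal
    infer_instance
  exact Subgroup.Normal.map inferInstance D.toTheta D.toTheta_surjective

/-- `F̈²` is stable under the conjugation action of `(Π^tp_X)^Θ` (it is the kernel of restriction to
the normal subgroup `(Δ^tp_Ÿ)^Θ`). [cite: MochizukiEtTh2009, Prop 1.5 (ii) p.23] -/
theorem Fdd2_conj_mem (hC : D.Compat) (t : D.GtpTheta) {z : D.H1Theta (D.GtpYdd.map D.toTheta)}
    (hz : z ∈ (Fdd2 : Subgroup (D.H1Theta (D.GtpYdd.map D.toTheta)))) :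
    haveI := hC.GtpYddTheta_normal
    ContH1.conj (MonoidHom.id D.GtpTheta) D.DeltaTheta t z ∈
      (Fdd2 : Subgroup (D.H1Theta (D.GtpYdd.map D.toTheta))) := by
  haveI := hC.GtpYddTheta_normal
  haveI := hC.DtpYddTheta_normal
  change ContH1.res _ _ _ _ = 1
  rw [ContH1.res_conj]
  have hz' : ContH1.res (MonoidHom.id D.GtpTheta) D.DeltaTheta
      (Subgroup.map_mono inf_le_left : (D.DtpYddN 1).map D.toTheta ≤ D.GtpYdd.map D.toTheta) z = 1 :=
    hz
  rw [hz', map_one]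

/-- Under `K = K̈`, every unit of `K̈` is a unit of `K` with the same underlying element of `ℚ̄_p`.
[cite: MochizukiEtTh2009, Def 2.5 p.39] -/
theorem Sec2Hyps.exists_unitsK (hS : D.Sec2Hyps) (w : (↥D.Kdd)ˣ) :
    ∃ w' : (↥D.K)ˣ, ((w' : D.K) : PadicAlgCl p) = ((w : D.Kdd) : PadicAlgCl p) := by
  have hmem : ((w : D.Kdd) : PadicAlgCl p) ∈ D.K := by
    rw [← hS.Kdd_eq]; exact (w : D.Kdd).2
  have hne : (⟨((w : D.Kdd) : PadicAlgCl p), hmem⟩ : D.K) ≠ 0 := by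
    intro h
    have h' : ((w : D.Kdd) : PadicAlgCl p) = 0 := congrArg Subtype.val h
    have hw : (w : D.Kdd) ≠ 0 := w.ne_zero
    exact hw (Subtype.ext h')
  exact ⟨Units.mk0 _ hne, rfl⟩

namespace KummerData

variable (E : D.KummerData)

/-- Under `K = K̈`: the Kummer class on `(Π^tp_Ÿ)^Θ` of an element of `K̈^× = K^×` is the restriction of
its Kummer class on `(Π^tp_Y)^Θ` (`res_kumY` + `hatIncl_toKHat`). [cite: MochizukiEtTh2009, Prop 1.5 (ii) p.23] -/
theorem exists_kumYdd_eq_res (hS : D.Sec2Hyps) (w : (↥D.Kdd)ˣ) :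
    ∃ k : E.KHat, E.kumYdd (E.toKddHat w) =
      ContH1.res (MonoidHom.id D.GtpTheta) D.DeltaTheta D.GtpYddTheta_le (E.kumY k) := by
  obtain ⟨w', hw'⟩ := hS.exists_unitsK w
  exact ⟨E.toKHat w', by rw [E.res_kumY, E.hatIncl_toKHat w' w hw']⟩

/-- The Kummer classes of `K^×` restricted to `(Π^tp_Ÿ)^Θ` lie in `F̈²` (given Prop 1.5 (ii)).
[cite: MochizukiEtTh2009, Prop 1.5 (ii) p.23] -/
theorem res_kumY_mem_Fdd2 (hC : D.Compat) (h15ii : Prop15ii E hC) (k : E.KHat) :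
    ContH1.res (MonoidHom.id D.GtpTheta) D.DeltaTheta D.GtpYddTheta_le (E.kumY k) ∈
      (Fdd2 : Subgroup (D.H1Theta (D.GtpYdd.map D.toTheta))) := by
  rw [E.res_kumY, h15ii.Fdd2_eq]
  exact ⟨_, rfl⟩

end KummerData

namespace EtaleThetaData

variable (E : D.EtaleThetaData)

/-- `η̈^Θ` is one of the étale theta classes `O^×_K̈ · η̈^Θ`. [cite: MochizukiEtTh2009, Prop 1.3 p.21] -/
theorem etaDd_mem_thetaClasses : E.etaDd ∈ E.thetaClasses := ⟨1, one_mem _, (one_mul _).symm⟩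

/-- The factor by which `σ ∈ Π^tp_X` moves the lift of `η̈^Θ` (Prop 1.5 (iii)):
`−2a·log(Ü) − a²·log(q̈) + log(u)`, `a = ` the image of `σ` in `Z`, as a class on `(Π^tp_Ÿ)^Θ`
(multiplicative notation). [cite: MochizukiEtTh2009, Prop 1.5 (iii) p.23] -/
theorem exists_lift_conj_eq (hC : D.Compat) (h15 : Prop15iii E hC) :
    ∃ x' : D.H1Theta (D.GtpYdd.map D.toTheta), D.inflTheta D.GtpYdd x' = E.etaDd ∧
      ∀ σ : D.PiTemp, ∃ u ∈ D.unitsOKdd,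
        haveI := hC.GtpYddTheta_normal
        ContH1.conj (MonoidHom.id D.GtpTheta) D.DeltaTheta (D.toTheta σ) x' =
          x' * (E.logUdd ^ (-(2 * Multiplicative.toAdd (D.toZ σ)))
            * E.kumYdd (E.toKddHat D.qddUnit) ^
                (-(Multiplicative.toAdd (D.toZ σ) * Multiplicative.toAdd (D.toZ σ)))
            * E.kumYdd (E.toKddHat u)) := by
  obtain ⟨x', ⟨h1, -, h3⟩, -⟩ := h15 E.etaDd E.etaDd_mem_thetaClasses
  refine ⟨x', h1, fun σ => ?_⟩
  obtain ⟨u, hu, h⟩ := h3 σ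
  exact ⟨u, hu, by rw [h]; simp only [mul_assoc]⟩

/-- **"`Ü²` descends to `Y`"** (p.49), class level: for `σ, x ∈ Π^tp_X` with images `a, b` in
`Z = ℤ`, the class `σ·η̈^Θ − (xσ)·η̈^Θ ∈ H¹(Π^tp_Ÿ, Δ_Θ)` equals (Prop 1.5 (iii), twice)
`2b·log(Ü) + b(b+2a)·log(q̈) + log(u/u')`, which under `K = K̈` is the restriction to `Π^tp_Ÿ` of the
inflation of the class `b·log(U) + log(k)` on `(Π^tp_Y)^Θ` for some `k ∈ (K^×)^∧`
(`log(U)|_Ÿ = 2·log(Ü)`, `res_logU`; `res_kumY`). [cite: MochizukiEtTh2009, Prop 2.14(ii) p.49] -/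
theorem conj_etaDd_div_eq (hC : D.Compat) (hS : D.Sec2Hyps) (h15 : Prop15iii E hC)
    (σ x : D.PiTemp) :
    ∃ k : E.KHat,
      haveI := hC.GtpYdd_normal
      ContH1.conj D.toTheta D.DeltaTheta σ E.etaDd * (ContH1.conj D.toTheta D.DeltaTheta (x * σ) E.etaDd)⁻¹ =
        ContH1.res D.toTheta D.DeltaTheta D.GtpYdd_le_GtpY
          (D.inflTheta D.GtpY (E.logU ^ Multiplicative.toAdd (D.toZ x) * E.kumY k)) := by
  haveI := hC.GtpYdd_normal
  haveI := hC.GtpYddTheta_normal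
  obtain ⟨x', hx', hΦ⟩ := E.exists_lift_conj_eq hC h15
  obtain ⟨u, -, hu⟩ := hΦ σ
  obtain ⟨u', -, hu'⟩ := hΦ (x * σ)
  set a : ℤ := Multiplicative.toAdd (D.toZ σ) with ha
  set b : ℤ := Multiplicative.toAdd (D.toZ x) with hb
  have hab : Multiplicative.toAdd (D.toZ (x * σ)) = b + a := by
    rw [map_mul, toAdd_mul]
  rw [hab] at hu'
  -- the unit of `K̈` collecting the `q̈`-powers and the two units
  set W : (↥D.Kdd)ˣ := D.qddUnit ^ ((b + a) * (b + a) - a * a) * (u * u'⁻¹) with hW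
  obtain ⟨k, hk⟩ := E.toKummerData.exists_kumYdd_eq_res hS W
  refine ⟨k, ?_⟩
  -- rewrite both conjugates of `η̈^Θ` through the lift `x'`
  have e1 : ContH1.conj D.toTheta D.DeltaTheta σ E.etaDd =
      D.inflTheta D.GtpYdd (ContH1.conj (MonoidHom.id D.GtpTheta) D.DeltaTheta (D.toTheta σ) x') := by
    rw [← hx']
    exact (ContH1.infl_conj (H₀ := D.GtpYdd) (H' := D.GtpYdd.map D.toTheta)
      (hψ := D.continuous_toTheta) le_rfl σ x').symm
  have e2 : ContH1.conj D.toTheta D.DeltaTheta (x * σ) E.etaDd =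
      D.inflTheta D.GtpYdd
        (ContH1.conj (MonoidHom.id D.GtpTheta) D.DeltaTheta (D.toTheta (x * σ)) x') := by
    rw [← hx']
    exact (ContH1.infl_conj (H₀ := D.GtpYdd) (H' := D.GtpYdd.map D.toTheta)
      (hψ := D.continuous_toTheta) le_rfl (x * σ) x').symm
  rw [e1, e2, hu, hu', ← map_inv (D.inflTheta D.GtpYdd), ← map_mul (D.inflTheta D.GtpYdd)]
  -- the algebra in the commutative group `H¹((Π^tp_Ÿ)^Θ, Δ_Θ)`
  have halg : x' * (E.logUdd ^ (-(2 * a)) * E.kumYdd (E.toKddHat D.qddUnit) ^ (-(a * a)) *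
        E.kumYdd (E.toKddHat u)) *
      (x' * (E.logUdd ^ (-(2 * (b + a))) * E.kumYdd (E.toKddHat D.qddUnit) ^ (-((b + a) * (b + a))) *
        E.kumYdd (E.toKddHat u')))⁻¹ =
      (E.logUdd ^ (2 : ℕ)) ^ b * E.kumYdd (E.toKddHat W) := by
    rw [hW, map_mul, map_mul, map_zpow, map_mul, map_inv, map_zpow, map_mul, map_inv]
    apply (Additive.ofMul : D.H1Theta (D.GtpYdd.map D.toTheta) ≃ _).injective
    simp only [ofMul_mul, ofMul_inv, ofMul_zpow, ofMul_pow]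
    module
  rw [halg, ← E.res_logU, hk, ← map_zpow, ← map_mul]
  exact (ContH1.infl_res (H₀ := D.GtpYdd) (H₁ := D.GtpY) (H' := D.GtpYdd.map D.toTheta)
    (H'' := D.GtpY.map D.toTheta) (hψ := D.continuous_toTheta) D.GtpYdd_le_GtpY D.GtpYddTheta_le
    le_rfl le_rfl _).symm

/-- **"`Gal(Y/X)` maps `Ü²` to a `K^×`-multiple of `Ü²`"** (p.49), class level: for `y ∈ Π^tp_X`,
`(y·log(U) − log(U))|_{(Π^tp_Ÿ)^Θ} ∈ F̈²` — from Prop 1.5 (iii) applied to `τ` and `yτ` with `τ ↦ −1`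
in `Z` (which gives `y·(2·log(Ü)) − 2·log(Ü) ∈ F̈² + y·F̈²`), Prop 1.5 (ii) (`F̈² ⊇` Kummer classes)
and the stability of `F̈²` under `y`. [cite: MochizukiEtTh2009, Prop 2.14(ii) p.49] -/
theorem res_conj_logU_div_mem_Fdd2 (hC : D.Compat) (h15 : Prop15iii E hC)
    (h15ii : Prop15ii E.toKummerData hC) (y : D.PiTemp) :
    haveI : (D.GtpY.map D.toTheta).Normal := GtpYTheta_normal
    ContH1.res (MonoidHom.id D.GtpTheta) D.DeltaTheta D.GtpYddTheta_le
        (ContH1.conj (MonoidHom.id D.GtpTheta) D.DeltaTheta (D.toTheta y) E.logU * E.logU⁻¹) ∈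
      (Fdd2 : Subgroup (D.H1Theta (D.GtpYdd.map D.toTheta))) := by
  haveI : (D.GtpY.map D.toTheta).Normal := GtpYTheta_normal
  haveI := hC.GtpYddTheta_normal
  obtain ⟨x', -, hΦ⟩ := E.exists_lift_conj_eq hC h15
  obtain ⟨τ, hτ⟩ := D.toZ_surjective (Multiplicative.ofAdd (-1 : ℤ))
  obtain ⟨u₁, -, h₁⟩ := hΦ τ
  obtain ⟨u₂, -, h₂⟩ := hΦ y
  obtain ⟨u₃, -, h₃⟩ := hΦ (y * τ)
  set c : ℤ := Multiplicative.toAdd (D.toZ y) with hc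
  have hτ' : Multiplicative.toAdd (D.toZ τ) = -1 := by rw [hτ]; rfl
  have hyτ : Multiplicative.toAdd (D.toZ (y * τ)) = c + -1 := by
    rw [map_mul, toAdd_mul, hτ']
  rw [hτ'] at h₁
  rw [hyτ] at h₃
  set L := E.logUdd with hL
  set Q := E.kumYdd (E.toKddHat D.qddUnit) with hQ
  set cy : D.H1Theta (D.GtpYdd.map D.toTheta) →* D.H1Theta (D.GtpYdd.map D.toTheta) :=
    ContH1.conj (MonoidHom.id D.GtpTheta) D.DeltaTheta (D.toTheta y) with hcy
  -- `y·(τ·x') = (yτ)·x'`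
  have key : cy x' * cy (L ^ (-(2 * (-1 : ℤ))) * Q ^ (-((-1 : ℤ) * -1)) * E.kumYdd (E.toKddHat u₁)) =
      x' * (L ^ (-(2 * (c + -1))) * Q ^ (-((c + -1) * (c + -1))) * E.kumYdd (E.toKddHat u₃)) := by
    rw [← map_mul, ← h₁, hcy, ← ContH1.conj_mul_apply, ← map_mul, h₃]
  rw [h₂, map_mul, map_mul, map_zpow, map_zpow] at key
  -- solve for `cy (L^2)`
  have hsolve : cy L ^ (2 : ℕ) * (L ^ (2 : ℕ))⁻¹ =
      (E.kumYdd (E.toKddHat u₃) * (E.kumYdd (E.toKddHat u₂))⁻¹ * Q ^ (2 * c - 1)) *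
        (cy Q * (cy (E.kumYdd (E.toKddHat u₁)))⁻¹) := by
    have key' := congrArg (Additive.ofMul : D.H1Theta (D.GtpYdd.map D.toTheta) ≃ _) key
    apply (Additive.ofMul : D.H1Theta (D.GtpYdd.map D.toTheta) ≃ _).injective
    simp only [ofMul_mul, ofMul_inv, ofMul_zpow, ofMul_pow] at key' ⊢
    rw [← sub_eq_zero] at key' ⊢
    rw [← key']
    module
  -- `res (cy logU * logU⁻¹) = cy (L^2) * (L^2)⁻¹`
  have hres : ContH1.res (MonoidHom.id D.GtpTheta) D.DeltaTheta D.GtpYddTheta_le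
      (ContH1.conj (MonoidHom.id D.GtpTheta) D.DeltaTheta (D.toTheta y) E.logU * E.logU⁻¹) =
      cy L ^ (2 : ℕ) * (L ^ (2 : ℕ))⁻¹ := by
    rw [map_mul, map_inv, ContH1.res_conj, E.res_logU, map_pow]
  rw [hres, hsolve]
  have hQ2 : Q ∈ (Fdd2 : Subgroup (D.H1Theta (D.GtpYdd.map D.toTheta))) := by
    rw [hQ, h15ii.Fdd2_eq]; exact ⟨_, rfl⟩
  have hU : ∀ v : (↥D.Kdd)ˣ, E.kumYdd (E.toKddHat v) ∈
      (Fdd2 : Subgroup (D.H1Theta (D.GtpYdd.map D.toTheta))) := fun v => by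
    rw [h15ii.Fdd2_eq]; exact ⟨_, rfl⟩
  exact mul_mem (mul_mem (mul_mem (hU u₃) (inv_mem (hU u₂))) (zpow_mem hQ2 _))
    (mul_mem (Fdd2_conj_mem hC _ hQ2) (inv_mem (Fdd2_conj_mem hC _ (hU u₁))))

/-- Consequently, for the "descended" classes `M = b·log(U) + log(k)` on `(Π^tp_Y)^Θ` and any
`y ∈ Π^tp_X`, the class `y·M − M` VANISHES on `(Δ^tp_Ÿ)^Θ` (it restricts into `F̈²`, the kernel of
restriction to `(Δ^tp_Ÿ)^Θ`). [cite: MochizukiEtTh2009, Prop 2.14(ii) p.49] -/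
theorem res_conj_descended_div_eq_one (hC : D.Compat) (h15 : Prop15iii E hC)
    (h15ii : Prop15ii E.toKummerData hC) (y : D.PiTemp) (b : ℤ) (k : E.KHat) :
    haveI : (D.GtpY.map D.toTheta).Normal := GtpYTheta_normal
    ContH1.res (MonoidHom.id D.GtpTheta) D.DeltaTheta
        ((Subgroup.map_mono inf_le_left : (D.DtpYddN 1).map D.toTheta ≤ D.GtpYdd.map D.toTheta).trans
          D.GtpYddTheta_le)
        (ContH1.conj (MonoidHom.id D.GtpTheta) D.DeltaTheta (D.toTheta y) (E.logU ^ b * E.kumY k) *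
          (E.logU ^ b * E.kumY k)⁻¹) = 1 := by
  haveI : (D.GtpY.map D.toTheta).Normal := GtpYTheta_normal
  haveI := hC.GtpYddTheta_normal
  set S := ContH1.conj (MonoidHom.id D.GtpTheta) D.DeltaTheta (D.toTheta y) (E.logU ^ b * E.kumY k) *
    (E.logU ^ b * E.kumY k)⁻¹ with hSdef
  have hmem : ContH1.res (MonoidHom.id D.GtpTheta) D.DeltaTheta D.GtpYddTheta_le S ∈
      (Fdd2 : Subgroup (D.H1Theta (D.GtpYdd.map D.toTheta))) := by
    have hsplit : S =
        (ContH1.conj (MonoidHom.id D.GtpTheta) D.DeltaTheta (D.toTheta y) E.logU * E.logU⁻¹) ^ b *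
          (ContH1.conj (MonoidHom.id D.GtpTheta) D.DeltaTheta (D.toTheta y) (E.kumY k) *
            (E.kumY k)⁻¹) := by
      rw [hSdef, map_mul, map_zpow]
      apply (Additive.ofMul : D.H1Theta (D.GtpY.map D.toTheta) ≃ _).injective
      simp only [ofMul_mul, ofMul_inv, ofMul_zpow]
      module
    rw [hsplit, map_mul, map_zpow]
    refine mul_mem (zpow_mem (E.res_conj_logU_div_mem_Fdd2 hC h15 h15ii y) _) ?_
    rw [map_mul, map_inv, ContH1.res_conj]
    exact mul_mem (Fdd2_conj_mem hC _ (E.toKummerData.res_kumY_mem_Fdd2 hC h15ii k))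
      (inv_mem (E.toKummerData.res_kumY_mem_Fdd2 hC h15ii k))
  have key : ContH1.res (MonoidHom.id D.GtpTheta) D.DeltaTheta
      (Subgroup.map_mono inf_le_left : (D.DtpYddN 1).map D.toTheta ≤ D.GtpYdd.map D.toTheta)
      (ContH1.res (MonoidHom.id D.GtpTheta) D.DeltaTheta D.GtpYddTheta_le S) = 1 := hmem
  rwa [ContH1.res_res] at key

end EtaleThetaData

end ThetaSetting

end Literature.AnabelianGeometry.EtaleTheta

end
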